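import Summits.BirchSwinnertonDyer.BirchSwinnertonDyer.Theses.QuadraticBranchSignedControl
import Summits.BirchSwinnertonDyer.BirchSwinnertonDyer.Theorems.QuadraticBranchSignedControlEtaDescentFrame
import Summits.BirchSwinnertonDyer.BirchSwinnertonDyer.Theorems.QuadraticBranchSignedControlPlusMainConjectureBranchSeams
import Summits.BirchSwinnertonDyer.BirchSwinnertonDyer.Theorems.QuadraticBranchSignedControlPlusEtaCMRankZeroOfBT26
import Summits.BirchSwinnertonDyer.BirchSwinnertonDyer.Theorems.QuadraticBranchSignedControlPlusEtaCMRankOneNodeOfBSDp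
import Summits.BirchSwinnertonDyer.Rank1Residual.Additive.SignedTwistOddBranchReadings
import HarnessLib

/-!
# Route `QuadraticBranchSignedControl` (rung K8, cell `bsd-potss`): item stmt-BirchSwinnertonDyer-19114
# `PlusMainConjectureBranch` ON ITS CM RANK-ZERO ROWS, IN THE ITEM'S OWN CURRENCY — the `F`-form node
# `QuadraticBranchPlusMainConjectureAt V p` at every CM Gss2 twist `V` whose additive partner `W` has
# `L(W,1) ≠ 0`, from NAMED FACTS ONLY (seat `bsd-potss-k8q-c2` g4)

WHAT. Item 19114 is `∀ V p, 5 ≤ p → good → a_p(V) = 0 → QuadraticBranchPlusMainConjectureAt V p` (the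
cell's `F`-form of Kobayashi's even main conjecture at `η`, over `ℚ_∞` and `F_∞`, `F = ℚ(√p*)`). Seat g3
(p478801, `EtaCMRankZeroBT26.quadraticBranchPlusEtaMainConjectureAt_of_bt26_of_hasCM_rankZero`) derived
the PRINT-currency `η`-form `QuadraticBranchPlusEtaMainConjectureAt V p` on every CM rank-`0` row from
named facts (Burungale–Tian 2026 Thm. 2.6, Burungale–Flach 2024, Kobayashi 2.2η, Kitajima–Otsuki 1.3η,
Poitou–Tate, modularity, GZK). THIS FILE moves that to the ITEM's currency: the `F`-form at the same
pairs, through the route's PROVED ∀-form descent frame `etaDescentFrame_proof` (item 19611, k8q-c3 /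
ctrl) and seat g0's per-pair currency seam
`quadraticBranchPlusMainConjectureAt_of_etaPlusMainConjecture_of_decomposition` (Thm. 1.2 + frame +
(C1⁺_η) ⟹ (C1_η)), at `K₀ = ℚ(ζ_p)` with the sign character of `√p*` (`exists_theta_eta_cyclotomicField`)
— the same composition as the landed glue 19609 `plusMainConjectureNonsurjBranchOfEta_proof`, with the
full frame (no tower condition: a CM tower is never onto, but the frame does not care).
* `plusMainConjectureAt_of_namedFacts_of_hasCM_rankZero` — per pair;
* `plusMainConjectureBranch_cmRankZeroRows_of_namedFacts` — item 19114's text with the binders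
  `V.HasCM` and `L(W,1) ≠ 0` (on the additive partner `W`, `C • W^{(p*)} = V`) inserted.
So on the record: 19114 HOLDS on its CM rank-`0` rows modulo named facts only (no per-row input, no
literature gap, no `μ` hypothesis); its CM rank-`1` rows are `BSD_p`-complete modulo 19116 (companion
file `…PlusEtaCMRankOneOfBT26`); its non-CM rows are the open problem (19601 / 19606 non-CM).

HONEST FRAMING (cell `bsd-potss`; FULL-BSD rank ≤ 1 programme, tranche 1b, D-0036/D-0074): THEOREMS
ONLY — no definition, no new named fact, no `sorry`, axioms standard; CONDITIONAL on the named facts in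
hypothesis position (`h12` Kobayashi Thm. 1.2, `h26` BT26 Thm. 2.6 ∘ Kob03, `hPT`, `hmod`, `hGZK`, `h22`,
`hKO`, `hS28` Burungale–Flach 2024 — none proved in the tree). Item 19114 stays OPEN (only an
UNCONDITIONAL theorem of its exact type closes it); nothing is booked; BSD is not proved for any curve
by this («bears on rung K8 of BirchSwinnertonDyer, never summit credit»).
`--supports stmt-BirchSwinnertonDyer-19114`.

References: [Kobayashi2003] Thm. 1.2 (p. 2), Thm. 2.2 (p. 5), §4 Even main conjecture (p. 8);
[BurungaleTian2026] Thm. 2.6 (p. 5); [BurungaleFlach2024] Thm. 1.1, Cor. 2; [KitajimaOtsuki2018] Main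
Thm. 1.3; [PollackRubin2004] p. 448; [GreenbergLNM1716] §3.
-/

set_option linter.dupNamespace false

noncomputable section

open scoped Classical

open CongruenceSubgroup Field WeierstrassCurve
open Literature.NumberTheory.EllipticCurves
open Literature.NumberTheory.EllipticCurves.ModularForms
open Literature.NumberTheory.GaloisRepresentations
open Literature.NumberTheory.GaloisCohomology
open Summit.BirchSwinnertonDyer.Rank1Residual.Additive
open Summit.BirchSwinnertonDyer.Rank1Residual.Additive.SignedTwist
open Summit.BirchSwinnertonDyer.BirchSwinnertonDyer.Theses.QuadraticBranchSignedControl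

namespace Summit.BirchSwinnertonDyer.BirchSwinnertonDyer.Theorems

namespace PlusMCBranchCMRankZero

/-- **Item 19114's conclusion at a CM Gss2 twist of analytic rank zero, from NAMED FACTS ONLY.**
`W` globally minimal, `p ≥ 5`, `V` a globally minimal model of `W^{(p*)}` (`C • W^{(p*)} = V`) with good
reduction at `p` and `a_p(V) = 0`, `V` CM, `L(W,1) ≠ 0`. Then the `F`-form (C1_η)
`QuadraticBranchPlusMainConjectureAt V p` — Kobayashi's even main conjecture in the cell's subtower form
over `ℚ_∞` and `F_∞ = ℚ(√p*)·ℚ_∞` — holds, GRANTED (hypothesis position, all published, none proved in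
the tree): Kobayashi Thm. 1.2 (`h12`), Burungale–Tian 2026 Thm. 2.6 ∘ Kobayashi §5/§7 (`h26`),
Poitou–Tate (`hPT`), modularity (`hmod`), Gross–Zagier–Kolyvagin (`hGZK`), Kobayashi Thm. 2.2 at `η`
(`h22`), Kitajima–Otsuki Main Thm. 1.3 at `η` (`hKO`), Burungale–Flach 2024 (`hS28`). Proof: seat g3's
`η`-form at the pair + the route's PROVED ∀-form descent frame (`etaDescentFrame_proof`) + seat g0's
per-pair currency seam at `K₀ = ℚ(ζ_p)`. CONDITIONAL; nothing booked.
[cite: Kobayashi2003, Thm. 1.2 (p. 2), §4 Even main conjecture (p. 8)] [cite: BurungaleTian2026, Thm. 2.6 (p. 5)]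
[cite: BurungaleFlach2024, Thm 1.1 and Cor. 2] [cite: PollackRubin2004, Theorem and remark p. 448] -/
theorem plusMainConjectureAt_of_namedFacts_of_hasCM_rankZero
    (h12 : Kobayashi2003.thm12_signedSelmerDual_finite_torsion)
    (h26 : BurungaleTian2026.thm26_etaKatoSequences_charIdeal_upToP_of_cm)
    (hPT : poitouTate_selmerStructure_duality_real ℚ) (hmod : hasEntireLFunction_rat)
    (hGZK : rank_eq_analyticRank_of_analyticRank_le_one)
    (h22 : Kobayashi2003.thm22_etaSignedSelmerDual_finite_torsion)
    (hKO : KitajimaOtsuki2018.mainThm13_etaSignedSelmerDual_noFiniteSubmodule)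
    (hS28 : bsdTriple_of_hasCM_of_L_one_ne_zero)
    (W : WeierstrassCurve ℚ) [W.IsElliptic] [W.IsGloballyMinimal] (p : ℕ) [hp : Fact p.Prime]
    (V : WeierstrassCurve ℚ) [V.IsElliptic] [V.IsGloballyMinimal] (C : VariableChange ℚ)
    (hp5 : 5 ≤ p) (hCV : C • W.quadraticTwist ((-1) ^ (p / 2) * p) = V)
    (hgood : V.HasGoodReductionAtPrime p) (hap : V.frobeniusTrace p = 0) (hCM : V.HasCM)
    (hLW : W.entireLFunction 1 ≠ 0) :
    QuadraticBranchPlusMainConjectureAt V p := by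
  have hp2 : p ≠ 2 := by omega
  haveI : NeZero p := ⟨hp.out.ne_zero⟩
  haveI : IsCyclotomicExtension {p} ℚ (CyclotomicField p ℚ) :=
    CyclotomicField.isCyclotomicExtension p ℚ
  haveI : (galRange (K := ℚ) (CyclotomicField p ℚ)).Normal := normal_galRange_cyclotomic p _
  obtain ⟨θ, ηq, -, -, -, hηK, hη1⟩ := exists_theta_eta_cyclotomicField p hp2
  -- the `η`-form at the pair (seat g3: BT26 + BF24 + Kob 2.2η + KO 1.3η + PT + modularity + GZK)
  have hη : QuadraticBranchPlusEtaMainConjectureAt V p :=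
    EtaCMRankZeroBT26.quadraticBranchPlusEtaMainConjectureAt_of_bt26_of_hasCM_rankZero W p h26 hPT hmod
      hGZK h22 hKO hS28 V C hp5 hCV hgood hap hCM hLW
  -- the route's PROVED ∀-form descent frame (item 19611)
  have hfr := etaDescentFrame_proof
  unfold Theses.QuadraticBranchSignedControl.EtaDescentFrame at hfr
  exact quadraticBranchPlusMainConjectureAt_of_etaPlusMainConjecture_of_decomposition h12
    (CyclotomicField p ℚ) ηq
    (fun κ γ hκ hγ hγK hγc F _ _ V' _ κF γF hF hθ hC' hκF hγF hζ =>
      hfr p hp5 (CyclotomicField p ℚ) ηq hηK hη1 V hgood hap κ γ hκ hγ hγK hγc F V' κF γF hF hθ hC' hκF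
        hγF hζ)
    (fun hp2' hgood' hap' hf ϖ hϖ Lη hL κ γ hκ hγ hγK hγc D =>
      hη (CyclotomicField p ℚ) ηq hηK hη1 hp2' hgood' hap' hf ϖ hϖ Lη hL κ γ hκ hγ hγK hγc D)

/-- **Item 19114 `PlusMainConjectureBranch` ON ITS CM RANK-ZERO ROWS — the item's text with the row
binders inserted** (`V.HasCM`, and `L(W,1) ≠ 0` for the additive partner `W`, `C • W^{(p*)} = V`): for every
`p ≥ 5` and every good `a_p = 0` CM twist `V`, `QuadraticBranchPlusMainConjectureAt V p`, GRANTED the eight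
named facts of the previous theorem. CONDITIONAL; item 19114 is NOT closed (its non-CM rows are the open
problem 19601 / 19606; its CM rows with `L(W,1) = 0` are the `μ`-part, `BSD_p`-complete modulo 19116 by
the companion file); nothing booked. [cite: Kobayashi2003, Thm. 1.2 (p. 2), §4 (p. 8)]
[cite: BurungaleTian2026, Thm. 2.6 and Rem. 2.7 (p. 5)] [cite: BurungaleFlach2024, Thm 1.1 and Cor. 2] -/
theorem plusMainConjectureBranch_cmRankZeroRows_of_namedFacts
    (h12 : Kobayashi2003.thm12_signedSelmerDual_finite_torsion)
    (h26 : BurungaleTian2026.thm26_etaKatoSequences_charIdeal_upToP_of_cm)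
    (hPT : poitouTate_selmerStructure_duality_real ℚ) (hmod : hasEntireLFunction_rat)
    (hGZK : rank_eq_analyticRank_of_analyticRank_le_one)
    (h22 : Kobayashi2003.thm22_etaSignedSelmerDual_finite_torsion)
    (hKO : KitajimaOtsuki2018.mainThm13_etaSignedSelmerDual_noFiniteSubmodule)
    (hS28 : bsdTriple_of_hasCM_of_L_one_ne_zero) :
    ∀ (V : WeierstrassCurve ℚ) [V.IsElliptic] [V.IsGloballyMinimal] (p : ℕ) [Fact p.Prime],
      5 ≤ p → V.HasGoodReductionAtPrime p → V.frobeniusTrace p = 0 → V.HasCM →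
      ∀ (W : WeierstrassCurve ℚ) [W.IsElliptic] [W.IsGloballyMinimal] (C : VariableChange ℚ),
        C • W.quadraticTwist ((-1) ^ (p / 2) * p) = V → W.entireLFunction 1 ≠ 0 →
        QuadraticBranchPlusMainConjectureAt V p := by
  intro V _ _ p _ hp5 hgood hap hCM W _ _ C hCV hLW
  exact plusMainConjectureAt_of_namedFacts_of_hasCM_rankZero h12 h26 hPT hmod hGZK h22 hKO hS28 W p V C
    hp5 hCV hgood hap hCM hLW

/-! ## §2 (APPENDED, seat g4, same session) The CM rank-ONE rows: item 19114's own node from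
`BSD_p(W)` + the route's residual 19116 at the pair + named facts -/

/-- **Item 19114's conclusion at a CM Gss2 twist of analytic rank ONE, from `BSD_p(W)`, the route's
residual (C2_η-GZ) at the pair and named facts.** `W` globally minimal, `p ≥ 5`, `C • W^{(p*)} = V` good
at `p` with `a_p(V) = 0`, `V` CM, `r_an(W) = 1`. GRANTED (hypothesis position): `h12` (Kob Thm. 1.2),
`h26` (BT26 Thm. 2.6 ∘ Kob03), `h22`, `hPT`, `hmod`, the cell's typed reading (R2)
`OddBranchStrictMinusNoFiniteSubmoduleAt W p`, the route's residual `QuadraticBranchMinusLeadingValuationAt W p 0`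
(item 19116 AT THE PAIR) and `BSDp W p` (for a CM curve of analytic rank one with additive reduction at
`p` NOT in print — cell bsd-cm's class O10): the `F`-form (C1_η) `QuadraticBranchPlusMainConjectureAt V p`.
Proof: the `η`-node at the pair (`EtaCMRankOneNode.quadraticBranchPlusEtaMainConjectureAt_of_bsdp_of_bt26_of_hasCM_rankOne`:
BT26 odd side + x1b's rank-one count + 19116 + the dictionary backwards + BT26's Thm. 7.4-for-CM) + the
route's PROVED ∀-form descent frame + seat g0's per-pair currency seam at `K₀ = ℚ(ζ_p)`, as in §1.
So modulo its own residual 19116 the route's main-conjecture input on the CM rank-one rows IS its output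
`BSD_p(W)` (the converse is the route's assembly). CONDITIONAL; nothing booked.
[cite: Kobayashi2003, Thm. 1.2 (p. 2), §4 (p. 8), Thm. 7.4 (p. 13)] [cite: BurungaleTian2026, Thm. 2.6 and Rem. 2.7 (p. 5)]
[cite: Miller2011LMS, §1 and Def. 1.1] -/
theorem plusMainConjectureAt_of_bsdp_of_hasCM_rankOne
    (h12 : Kobayashi2003.thm12_signedSelmerDual_finite_torsion)
    (h26 : BurungaleTian2026.thm26_etaKatoSequences_charIdeal_upToP_of_cm)
    (h22 : Kobayashi2003.thm22_etaSignedSelmerDual_finite_torsion)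
    (hPT : poitouTate_selmerStructure_duality_real ℚ) (hmod : hasEntireLFunction_rat)
    (W : WeierstrassCurve ℚ) [W.IsElliptic] [W.IsGloballyMinimal] (p : ℕ) [hp : Fact p.Prime]
    (hR2 : OddBranchStrictMinusNoFiniteSubmoduleAt W p) (h2 : QuadraticBranchMinusLeadingValuationAt W p 0)
    (V : WeierstrassCurve ℚ) [V.IsElliptic] [V.IsGloballyMinimal] (C : VariableChange ℚ)
    (hp5 : 5 ≤ p) (hCV : C • W.quadraticTwist ((-1) ^ (p / 2) * p) = V)
    (hgood : V.HasGoodReductionAtPrime p) (hap : V.frobeniusTrace p = 0) (hCM : V.HasCM)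
    (hr : W.analyticRank = 1) (hB : BSDp W p) :
    QuadraticBranchPlusMainConjectureAt V p := by
  have hp2 : p ≠ 2 := by omega
  haveI : NeZero p := ⟨hp.out.ne_zero⟩
  haveI : IsCyclotomicExtension {p} ℚ (CyclotomicField p ℚ) :=
    CyclotomicField.isCyclotomicExtension p ℚ
  haveI : (galRange (K := ℚ) (CyclotomicField p ℚ)).Normal := normal_galRange_cyclotomic p _
  obtain ⟨θ, ηq, -, -, -, hηK, hη1⟩ := exists_theta_eta_cyclotomicField p hp2
  -- the `η`-node at the pair (this seat, file `…PlusEtaCMRankOneNodeOfBSDp`)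
  have hη : QuadraticBranchPlusEtaMainConjectureAt V p :=
    EtaCMRankOneNode.quadraticBranchPlusEtaMainConjectureAt_of_bsdp_of_bt26_of_hasCM_rankOne W p h26 h22
      hPT hmod hR2 h2 V C hp5 hCV hgood hap hCM hr hB
  have hfr := etaDescentFrame_proof
  unfold Theses.QuadraticBranchSignedControl.EtaDescentFrame at hfr
  exact quadraticBranchPlusMainConjectureAt_of_etaPlusMainConjecture_of_decomposition h12
    (CyclotomicField p ℚ) ηq
    (fun κ γ hκ hγ hγK hγc F _ _ V' _ κF γF hF hθ hC' hκF hγF hζ =>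
      hfr p hp5 (CyclotomicField p ℚ) ηq hηK hη1 V hgood hap κ γ hκ hγ hγK hγc F V' κF γF hF hθ hC' hκF
        hγF hζ)
    (fun hp2' hgood' hap' hf ϖ hϖ Lη hL κ γ hκ hγ hγK hγc D =>
      hη (CyclotomicField p ℚ) ηq hηK hη1 hp2' hgood' hap' hf ϖ hϖ Lη hL κ γ hκ hγ hγK hγc D)

/-- **Item 19114 `PlusMainConjectureBranch` ON ITS CM RANK-ONE ROWS — the item's text with the row
binders and inputs inserted** (`V.HasCM`; on the additive partner `W`, `C • W^{(p*)} = V`: `r_an(W) = 1`,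
(R2), 19116 at the pair, `BSDp W p`), GRANTED `h12`, `h26`, `h22`, `hPT`, `hmod`. With §1: 19114 holds
on ALL its CM rows modulo named facts, the route's own residual 19116 (rank-one rows) and `BSD_p(W)`
(rank-one rows; bsd-cm O10). CONDITIONAL; item 19114 is NOT closed; nothing booked.
[cite: Kobayashi2003, Thm. 1.2 (p. 2), §4 (p. 8)] [cite: BurungaleTian2026, Thm. 2.6 and Rem. 2.7 (p. 5)] -/
theorem plusMainConjectureBranch_cmRankOneRows_of_namedFacts_of_bsdp
    (h12 : Kobayashi2003.thm12_signedSelmerDual_finite_torsion)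
    (h26 : BurungaleTian2026.thm26_etaKatoSequences_charIdeal_upToP_of_cm)
    (h22 : Kobayashi2003.thm22_etaSignedSelmerDual_finite_torsion)
    (hPT : poitouTate_selmerStructure_duality_real ℚ) (hmod : hasEntireLFunction_rat) :
    ∀ (V : WeierstrassCurve ℚ) [V.IsElliptic] [V.IsGloballyMinimal] (p : ℕ) [Fact p.Prime],
      5 ≤ p → V.HasGoodReductionAtPrime p → V.frobeniusTrace p = 0 → V.HasCM →
      ∀ (W : WeierstrassCurve ℚ) [W.IsElliptic] [W.IsGloballyMinimal] (C : VariableChange ℚ),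
        C • W.quadraticTwist ((-1) ^ (p / 2) * p) = V → W.analyticRank = 1 →
        OddBranchStrictMinusNoFiniteSubmoduleAt W p → QuadraticBranchMinusLeadingValuationAt W p 0 →
        BSDp W p → QuadraticBranchPlusMainConjectureAt V p := by
  intro V _ _ p _ hp5 hgood hap hCM W _ _ C hCV hr hR2 h2 hB
  exact plusMainConjectureAt_of_bsdp_of_hasCM_rankOne h12 h26 h22 hPT hmod W p hR2 h2 V C hp5 hCV hgood
    hap hCM hr hB

end PlusMCBranchCMRankZero

end Summit.BirchSwinnertonDyer.BirchSwinnertonDyer.Theorems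

end
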